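import Mathlib
import Summits.NavierStokesRegularity.NavierStokesRegularity.Theorems.EulerZoomLiouvillePowerGaugeEulerLiouvilleTransportMeanValue
import HarnessLib

/-!
# R49 plates t52-TB (final) and t52-KV: TRANSPORT SPHERE LAW, TRANSPORT BALL LAW, KNOT VENTILATION
# (nsreg-p2 ROUND-49 «EVERY BALL BREATHES», `NsregP2.R49.TransportSphereLaw` / `TransportBallLaw` / `KnotVentilation`, texts
# VERBATIM from `r49/Sketch49.lean` l.152–162 / l.114–124 / l.130–141 with `transportW`/`modPressure` UNFOLDED; seat ns-sfl-p1 g8,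
# `--supports stmt-NavierStokesRegularity-19832 --as helper`)

With `W = γ(y − c) + V`, `Π = P − ½γ(1−γ)‖y − c‖²`, `z = y − x₀`, `δ > 0`:
* `transportSphereLaw (γ)` — `δ³ · sphereIntegral volume (z ↦ ⟪W(z + x₀), z⟫²/‖z‖² + Π(z + x₀)) δ = ∫_{B_δ(x₀)}(‖W‖² + 3Π) + (4π/5)γ(5γ−1)δ⁵`
  (the tent law `transportMeanValueFormula` differentiated in the radius: `sphereLaw_of_tentLaw`, the remainder
  `(2π/15)γ(5γ−1)ρ⁶` contributing `(4π/5)γ(5γ−1)δ⁵`);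
* `transportBallLaw (γ)` — the same as a `HasDerivAt` statement for `r ↦ ∫_{B_r(x₀)}(⟪W,z⟫²/‖z‖² + Π)` (`hasDerivAt_integral_ball_normalSq_add`:
  ball integrals of `⟪U,z⟫²/‖z‖² + p` are differentiable in the radius with derivative `δ²·S(δ)`, `S` the continuous radial density);
* `knotVentilation (γ)` — the corollary `⟨W_n²⟩_{∂B} ≥ ⟨Π⟩_B − ⟨Π⟩_{∂B} + γ(5γ−1)δ²/5` in the typed form (uniqueness of derivatives and
  `∫_B ‖W‖² ≥ 0`).

HONEST FRAMING: instrument identities of ROUND-49 (class-free, about hypothetical profiles); nothing about the crux E (19832 OPEN)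
or NS regularity is proved here. [cite: ChaeWolf2016, Lemma 2.1 (2.1)] [nsreg-p2 R49 §2.5–2.8; folklore]
-/

noncomputable section

set_option linter.dupNamespace false

open MeasureTheory Set Filter Topology Metric Function
open scoped RealInnerProductSpace Topology

namespace Summit.NavierStokesRegularity.NavierStokesRegularity.Theorems.PowerGaugeEulerLiouville

open Literature.Analysis Literature.Analysis.FluidPDE

namespace ClassicalProfile

/-! ## A sphere law from a tent law with a smooth remainder -/

/-- SPHERE LAW FROM A TENT LAW WITH REMAINDER. If continuous `V`, `P` satisfy the tent (mean-value) law on every ball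
`B_ρ(x₀)` up to a remainder `E ρ`, `∫_{B_ρ}(⟪V,z⟫²/‖z‖ + ‖z‖P) = ∫_{B_ρ}(ρ − ‖z‖)(‖V‖² + 3P) + E ρ` (`z = y − x₀`), and `E` has
derivative `e` at `δ > 0`, then `δ³ · sphereIntegral (⟪V,z⟫²/‖z‖² + P) δ = ∫_{B_δ}(‖V‖² + 3P) + e`: both sides of the tent law are
`C¹` in `ρ` (shell formula, continuous radial densities) and the identity is the equality of their derivatives at `δ`. -/
theorem sphereLaw_of_tentLaw {V : EuclideanSpace ℝ (Fin 3) → EuclideanSpace ℝ (Fin 3)}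
    {P : EuclideanSpace ℝ (Fin 3) → ℝ} (hV : Continuous V) (hP : Continuous P) (x₀ : EuclideanSpace ℝ (Fin 3))
    {E : ℝ → ℝ} {e : ℝ}
    (hMV : ∀ ρ : ℝ, 0 < ρ →
      ∫ y in ball x₀ ρ, (⟪V y, y - x₀⟫ ^ 2 / ‖y - x₀‖ + ‖y - x₀‖ * P y)
        = (∫ y in ball x₀ ρ, (ρ - ‖y - x₀‖) * (‖V y‖ ^ 2 + 3 * P y)) + E ρ)
    {δ : ℝ} (hδ : 0 < δ) (hE : HasDerivAt E e δ) :
    δ ^ 3 * sphereIntegral volume (fun z : EuclideanSpace ℝ (Fin 3) => ⟪V (z + x₀), z⟫ ^ 2 / ‖z‖ ^ 2 + P (z + x₀)) δ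
      = (∫ y in ball x₀ δ, (‖V y‖ ^ 2 + 3 * P y)) + e := by
  -- the two continuous radial densities
  set S : ℝ → ℝ := fun r => ∫ α : sphere (0 : EuclideanSpace ℝ (Fin 3)) 1,
      (⟪V (r • (α : EuclideanSpace ℝ (Fin 3)) + x₀), (α : EuclideanSpace ℝ (Fin 3))⟫ ^ 2 +
        P (r • (α : EuclideanSpace ℝ (Fin 3)) + x₀))
        ∂(volume : Measure (EuclideanSpace ℝ (Fin 3))).toSphere with hS
  set Sf : ℝ → ℝ := fun r => sphereIntegral volume
      (fun z : EuclideanSpace ℝ (Fin 3) => ‖V (z + x₀)‖ ^ 2 + 3 * P (z + x₀)) r with hSf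
  have hSc : Continuous S := continuous_radialNormalDensity hV hP x₀
  have hfc : Continuous fun z : EuclideanSpace ℝ (Fin 3) => ‖V (z + x₀)‖ ^ 2 + 3 * P (z + x₀) := by fun_prop
  have hSfc : Continuous Sf := continuous_sphereIntegral volume hfc
  have hcn : Continuous fun y : EuclideanSpace ℝ (Fin 3) => ‖y - x₀‖ := continuous_norm.comp (continuous_sub_right x₀)
  -- integrability of the three ball integrands
  have hK : ∀ ρ : ℝ, IsCompact (closedBall x₀ ρ) := fun ρ => isCompact_closedBall x₀ ρ
  have hIf : ∀ ρ : ℝ, IntegrableOn (fun y => ‖V y‖ ^ 2 + 3 * P y) (ball x₀ ρ) := fun ρ =>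
    ((by fun_prop : Continuous fun y => ‖V y‖ ^ 2 + 3 * P y).continuousOn.integrableOn_compact (hK ρ)).mono_set
      ball_subset_closedBall
  have hIR : ∀ ρ : ℝ, IntegrableOn (fun y => (ρ - ‖y - x₀‖) * (‖V y‖ ^ 2 + 3 * P y)) (ball x₀ ρ) := fun ρ =>
    ((by fun_prop : Continuous fun y => (ρ - ‖y - x₀‖) * (‖V y‖ ^ 2 + 3 * P y)).continuousOn.integrableOn_compact
      (hK ρ)).mono_set ball_subset_closedBall
  have hIL : ∀ ρ : ℝ, IntegrableOn (fun y => ⟪V y, y - x₀⟫ ^ 2 / ‖y - x₀‖ + ‖y - x₀‖ * P y) (ball x₀ ρ) := by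
    intro ρ
    have hc : Continuous fun y => ‖V y‖ ^ 2 * ‖y - x₀‖ + ‖y - x₀‖ * |P y| := by fun_prop
    have hcont_inner : Continuous fun y : EuclideanSpace ℝ (Fin 3) => ⟪V y, y - x₀⟫ :=
      hV.inner (continuous_id.sub continuous_const)
    refine Integrable.mono' ((hc.continuousOn.integrableOn_compact (hK ρ)).mono_set ball_subset_closedBall)
      ((((hcont_inner.measurable.pow_const 2).div hcn.measurable).add
        (hcn.measurable.mul hP.measurable)).aestronglyMeasurable) (ae_of_all _ fun y => ?_)
    rw [Real.norm_eq_abs]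
    have hcs : ⟪V y, y - x₀⟫ ^ 2 / ‖y - x₀‖ ≤ ‖V y‖ ^ 2 * ‖y - x₀‖ := by
      by_cases hz : y - x₀ = 0
      · simp [hz]
      · rw [div_le_iff₀ (norm_pos_iff.2 hz)]
        have h := abs_real_inner_le_norm (V y) (y - x₀)
        have h0 : 0 ≤ |⟪V y, y - x₀⟫| := abs_nonneg _
        nlinarith [sq_abs ⟪V y, y - x₀⟫, norm_nonneg (V y), norm_nonneg (y - x₀),
          mul_nonneg (norm_nonneg (V y)) (norm_nonneg (y - x₀))]
    calc |⟪V y, y - x₀⟫ ^ 2 / ‖y - x₀‖ + ‖y - x₀‖ * P y|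
        ≤ |⟪V y, y - x₀⟫ ^ 2 / ‖y - x₀‖| + |‖y - x₀‖ * P y| := abs_add_le _ _
      _ ≤ ‖V y‖ ^ 2 * ‖y - x₀‖ + ‖y - x₀‖ * |P y| := by
          rw [abs_of_nonneg (div_nonneg (sq_nonneg _) (norm_nonneg _)), abs_mul, abs_of_nonneg (norm_nonneg _)]
          gcongr
  -- the three ball integrals in polar coordinates
  have hF : ∀ ρ : ℝ, 0 < ρ → ∫ y in ball x₀ ρ, (‖V y‖ ^ 2 + 3 * P y) = ∫ r in (0 : ℝ)..ρ, r ^ 2 * Sf r := fun ρ hρ =>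
    setIntegral_ball_eq_intervalIntegral_sphereIntegral (hIf ρ) hρ.le
  have hL : ∀ ρ : ℝ, 0 < ρ →
      ∫ y in ball x₀ ρ, (⟪V y, y - x₀⟫ ^ 2 / ‖y - x₀‖ + ‖y - x₀‖ * P y) = ∫ r in (0 : ℝ)..ρ, r ^ 3 * S r := by
    intro ρ hρ
    rw [setIntegral_ball_eq_intervalIntegral_sphereIntegral (hIL ρ) hρ.le]
    refine intervalIntegral.integral_congr_ae (ae_of_all _ fun r hr => ?_)
    rw [uIoc_of_le hρ.le] at hr
    have e : (fun z : EuclideanSpace ℝ (Fin 3) => ⟪V (z + x₀), z + x₀ - x₀⟫ ^ 2 / ‖z + x₀ - x₀‖ + ‖z + x₀ - x₀‖ * P (z + x₀)) =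
        fun z => ⟪V (z + x₀), z⟫ ^ 2 / ‖z‖ + ‖z‖ * P (z + x₀) := by
      funext z; simp only [add_sub_cancel_right]
    rw [e, sphereIntegral_tentIntegrand_eq x₀ hr.1]
    ring
  have hR : ∀ ρ : ℝ, 0 < ρ → ∫ y in ball x₀ ρ, (ρ - ‖y - x₀‖) * (‖V y‖ ^ 2 + 3 * P y) =
      ρ * (∫ r in (0 : ℝ)..ρ, r ^ 2 * Sf r) - ∫ r in (0 : ℝ)..ρ, r ^ 3 * Sf r := by
    intro ρ hρ
    rw [setIntegral_ball_eq_intervalIntegral_sphereIntegral (hIR ρ) hρ.le]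
    have e : ∀ r ∈ uIoc (0 : ℝ) ρ, r ^ 2 * sphereIntegral volume
        (fun z : EuclideanSpace ℝ (Fin 3) => (ρ - ‖z + x₀ - x₀‖) * (‖V (z + x₀)‖ ^ 2 + 3 * P (z + x₀))) r =
        ρ * (r ^ 2 * Sf r) - r ^ 3 * Sf r := by
      intro r hr
      rw [uIoc_of_le hρ.le] at hr
      have e1 : (fun z : EuclideanSpace ℝ (Fin 3) => (ρ - ‖z + x₀ - x₀‖) * (‖V (z + x₀)‖ ^ 2 + 3 * P (z + x₀))) =
          fun z => (fun t : ℝ => ρ - t) ‖z‖ * (fun w => ‖V w‖ ^ 2 + 3 * P w) (z + x₀) := by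
        funext z; simp only [add_sub_cancel_right]
      rw [e1, sphereIntegral_radial_mul (fun t : ℝ => ρ - t) (fun w => ‖V w‖ ^ 2 + 3 * P w) x₀ hr.1.le]
      simp only [hSf]
      ring
    have i1 : IntervalIntegrable (fun r : ℝ => ρ * (r ^ 2 * Sf r)) volume 0 ρ :=
      (continuous_const.mul ((continuous_pow 2).mul hSfc)).intervalIntegrable _ _
    have i2 : IntervalIntegrable (fun r : ℝ => r ^ 3 * Sf r) volume 0 ρ :=
      ((continuous_pow 3).mul hSfc).intervalIntegrable _ _
    rw [intervalIntegral.integral_congr_ae (ae_of_all _ e), intervalIntegral.integral_sub i1 i2,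
      intervalIntegral.integral_const_mul]
  -- the tent identity in radial form on a neighbourhood of `δ`
  have heq : (fun ρ : ℝ => ∫ r in (0 : ℝ)..ρ, r ^ 3 * S r) =ᶠ[𝓝 δ]
      fun ρ => ρ * (∫ r in (0 : ℝ)..ρ, r ^ 2 * Sf r) - (∫ r in (0 : ℝ)..ρ, r ^ 3 * Sf r) + E ρ := by
    filter_upwards [Ioi_mem_nhds hδ] with ρ hρ
    rw [← hL ρ hρ, ← hR ρ hρ, hMV ρ hρ]
  -- differentiate both sides at `δ`
  have hdL : HasDerivAt (fun ρ : ℝ => ∫ r in (0 : ℝ)..ρ, r ^ 3 * S r) (δ ^ 3 * S δ) δ :=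
    (((continuous_pow 3).mul hSc).integral_hasStrictDerivAt 0 δ).hasDerivAt
  have hdA : HasDerivAt (fun ρ : ℝ => ∫ r in (0 : ℝ)..ρ, r ^ 2 * Sf r) (δ ^ 2 * Sf δ) δ :=
    (((continuous_pow 2).mul hSfc).integral_hasStrictDerivAt 0 δ).hasDerivAt
  have hdB : HasDerivAt (fun ρ : ℝ => ∫ r in (0 : ℝ)..ρ, r ^ 3 * Sf r) (δ ^ 3 * Sf δ) δ :=
    (((continuous_pow 3).mul hSfc).integral_hasStrictDerivAt 0 δ).hasDerivAt
  have hdR : HasDerivAt (fun ρ : ℝ => ρ * (∫ r in (0 : ℝ)..ρ, r ^ 2 * Sf r) - (∫ r in (0 : ℝ)..ρ, r ^ 3 * Sf r) + E ρ)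
      (1 * (∫ r in (0 : ℝ)..δ, r ^ 2 * Sf r) + δ * (δ ^ 2 * Sf δ) - δ ^ 3 * Sf δ + e) δ :=
    (((hasDerivAt_id δ).mul hdA).sub hdB).add hE
  have huniq := hdL.unique (hdR.congr_of_eventuallyEq heq)
  -- assemble
  rw [sphereIntegral_normalSq_eq x₀ hδ, hF δ hδ]
  have hSδ : S δ = ∫ α : sphere (0 : EuclideanSpace ℝ (Fin 3)) 1,
      (⟪V (δ • (α : EuclideanSpace ℝ (Fin 3)) + x₀), (α : EuclideanSpace ℝ (Fin 3))⟫ ^ 2 +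
        P (δ • (α : EuclideanSpace ℝ (Fin 3)) + x₀))
        ∂(volume : Measure (EuclideanSpace ℝ (Fin 3))).toSphere := rfl
  rw [← hSδ, huniq]
  ring

/-! ## Ball integrals of `⟪U,z⟫²/‖z‖² + p` are differentiable in the radius -/

/-- The singular density `y ↦ ⟪U y, y − x₀⟫²/‖y − x₀‖² + p y` (bounded by `‖U‖² + |p|`) is integrable on every ball
(`U`, `p` continuous). [folklore] -/
theorem integrableOn_ball_normalSq_add {U : EuclideanSpace ℝ (Fin 3) → EuclideanSpace ℝ (Fin 3)}
    {p : EuclideanSpace ℝ (Fin 3) → ℝ} (hU : Continuous U) (hp : Continuous p) (x₀ : EuclideanSpace ℝ (Fin 3)) (r : ℝ) :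
    IntegrableOn (fun y => ⟪U y, y - x₀⟫ ^ 2 / ‖y - x₀‖ ^ 2 + p y) (ball x₀ r) volume := by
  have hcn : Continuous fun y : EuclideanSpace ℝ (Fin 3) => ‖y - x₀‖ := continuous_norm.comp (continuous_sub_right x₀)
  have hci : Continuous fun y : EuclideanSpace ℝ (Fin 3) => ⟪U y, y - x₀⟫ := hU.inner (continuous_id.sub continuous_const)
  have hc : Continuous fun y => ‖U y‖ ^ 2 + |p y| := by fun_prop
  refine Integrable.mono' ((hc.continuousOn.integrableOn_compact (isCompact_closedBall x₀ r)).mono_set ball_subset_closedBall)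
    ((((hci.measurable.pow_const 2).div (hcn.measurable.pow_const 2)).add hp.measurable).aestronglyMeasurable)
    (ae_of_all _ fun y => ?_)
  rw [Real.norm_eq_abs]
  have h1 : ⟪U y, y - x₀⟫ ^ 2 / ‖y - x₀‖ ^ 2 ≤ ‖U y‖ ^ 2 := by
    by_cases hz : y - x₀ = 0
    · simp [hz]
    · rw [div_le_iff₀ (by positivity)]
      have h := abs_real_inner_le_norm (U y) (y - x₀)
      have h0 : 0 ≤ |⟪U y, y - x₀⟫| := abs_nonneg _
      nlinarith [sq_abs ⟪U y, y - x₀⟫, norm_nonneg (U y), norm_nonneg (y - x₀),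
        mul_nonneg (norm_nonneg (U y)) (norm_nonneg (y - x₀))]
  calc |⟪U y, y - x₀⟫ ^ 2 / ‖y - x₀‖ ^ 2 + p y| ≤ |⟪U y, y - x₀⟫ ^ 2 / ‖y - x₀‖ ^ 2| + |p y| := abs_add_le _ _
    _ ≤ ‖U y‖ ^ 2 + |p y| := by
        rw [abs_of_nonneg (div_nonneg (sq_nonneg _) (sq_nonneg _))]
        gcongr

/-- **Ball integrals of `⟪U,z⟫²/‖z‖² + p` are differentiable in the radius** (`U`, `p` continuous, `δ > 0`): with the continuous
radial density `S(r) = ∫_σ (⟪U(rα + x₀), α⟫² + p(rα + x₀)) dσ(α)`,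
`d/dr|_{r=δ} ∫_{B_r(x₀)} (⟪U,z⟫²/‖z‖² + p) = δ² S(δ)` (`= ∮_{∂B_δ(x₀)} (U_n² + p) dS`). [folklore (polar coordinates, FTC)] -/
theorem hasDerivAt_integral_ball_normalSq_add {U : EuclideanSpace ℝ (Fin 3) → EuclideanSpace ℝ (Fin 3)}
    {p : EuclideanSpace ℝ (Fin 3) → ℝ} (hU : Continuous U) (hp : Continuous p) (x₀ : EuclideanSpace ℝ (Fin 3)) {δ : ℝ}
    (hδ : 0 < δ) :
    HasDerivAt (fun r => ∫ y in ball x₀ r, (⟪U y, y - x₀⟫ ^ 2 / ‖y - x₀‖ ^ 2 + p y))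
      (δ ^ 2 * ∫ α : sphere (0 : EuclideanSpace ℝ (Fin 3)) 1,
        (⟪U (δ • (α : EuclideanSpace ℝ (Fin 3)) + x₀), (α : EuclideanSpace ℝ (Fin 3))⟫ ^ 2 +
          p (δ • (α : EuclideanSpace ℝ (Fin 3)) + x₀))
          ∂(volume : Measure (EuclideanSpace ℝ (Fin 3))).toSphere) δ := by
  set S : ℝ → ℝ := fun r => ∫ α : sphere (0 : EuclideanSpace ℝ (Fin 3)) 1,
      (⟪U (r • (α : EuclideanSpace ℝ (Fin 3)) + x₀), (α : EuclideanSpace ℝ (Fin 3))⟫ ^ 2 +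
        p (r • (α : EuclideanSpace ℝ (Fin 3)) + x₀))
        ∂(volume : Measure (EuclideanSpace ℝ (Fin 3))).toSphere with hS
  have hSc : Continuous S := continuous_radialNormalDensity hU hp x₀
  -- the ball integral in polar coordinates, for every positive radius
  have hball : ∀ r : ℝ, 0 < r →
      ∫ y in ball x₀ r, (⟪U y, y - x₀⟫ ^ 2 / ‖y - x₀‖ ^ 2 + p y) = ∫ ρ in (0 : ℝ)..r, ρ ^ 2 * S ρ := by
    intro r hr
    rw [setIntegral_ball_eq_intervalIntegral_sphereIntegral (integrableOn_ball_normalSq_add hU hp x₀ r) hr.le]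
    refine intervalIntegral.integral_congr_ae (ae_of_all _ fun ρ hρ => ?_)
    rw [uIoc_of_le hr.le] at hρ
    have e : (fun z : EuclideanSpace ℝ (Fin 3) => ⟪U (z + x₀), z + x₀ - x₀⟫ ^ 2 / ‖z + x₀ - x₀‖ ^ 2 + p (z + x₀)) =
        fun z => ⟪U (z + x₀), z⟫ ^ 2 / ‖z‖ ^ 2 + p (z + x₀) := by
      funext z; simp only [add_sub_cancel_right]
    rw [e, sphereIntegral_normalSq_eq x₀ hρ.1]
  have heq : (fun r => ∫ ρ in (0 : ℝ)..r, ρ ^ 2 * S ρ) =ᶠ[𝓝 δ]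
      fun r => ∫ y in ball x₀ r, (⟪U y, y - x₀⟫ ^ 2 / ‖y - x₀‖ ^ 2 + p y) := by
    filter_upwards [Ioi_mem_nhds hδ] with r hr
    exact (hball r hr).symm
  have hd : HasDerivAt (fun r => ∫ ρ in (0 : ℝ)..r, ρ ^ 2 * S ρ) (δ ^ 2 * S δ) δ :=
    (((continuous_pow 2).mul hSc).integral_hasStrictDerivAt 0 δ).hasDerivAt
  exact hd.congr_of_eventuallyEq heq.symm

/-! ## The three laws for `γ`-profiles -/

/-- **TRANSPORT SPHERE LAW** (`NsregP2.R49.TransportSphereLaw γ`, text VERBATIM, `transportW`/`modPressure` unfolded):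
`δ³ · sphereIntegral volume (z ↦ ⟪W(z+x₀), z⟫²/‖z‖² + Π(z+x₀)) δ = ∫_{B_δ(x₀)}(‖W‖² + 3Π) + (4π/5)γ(5γ−1)δ⁵`. [nsreg-p2 R49 §2.7] -/
theorem transportSphereLaw (γ : ℝ) :
    ∀ (c : EuclideanSpace ℝ (Fin 3)) (V : EuclideanSpace ℝ (Fin 3) → EuclideanSpace ℝ (Fin 3)) (P : EuclideanSpace ℝ (Fin 3) → ℝ),
      IsSelfSimilarEulerProfile γ c V P →
      ∀ (x₀ : EuclideanSpace ℝ (Fin 3)) (δ : ℝ), 0 < δ →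
        δ ^ 3 * sphereIntegral volume
            (fun z : EuclideanSpace ℝ (Fin 3) => ⟪γ • (z + x₀ - c) + V (z + x₀), z⟫ ^ 2 / ‖z‖ ^ 2
              + (P (z + x₀) - γ * (1 - γ) / 2 * ‖z + x₀ - c‖ ^ 2)) δ
          = (∫ y in ball x₀ δ, (‖γ • (y - c) + V y‖ ^ 2 + 3 * (P y - γ * (1 - γ) / 2 * ‖y - c‖ ^ 2)))
            + 4 * Real.pi / 5 * γ * (5 * γ - 1) * δ ^ 5 := by
  intro c V P hprof x₀ δ hδ
  have hWc : Continuous fun y => γ • (y - c) + V y := by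
    have := hprof.contDiff_velocity.continuous; fun_prop
  have hPic : Continuous fun y => P y - γ * (1 - γ) / 2 * ‖y - c‖ ^ 2 := by
    have := hprof.contDiff_pressure.continuous; fun_prop
  have hE : HasDerivAt (fun ρ : ℝ => 2 * Real.pi / 15 * γ * (5 * γ - 1) * ρ ^ 6)
      (2 * Real.pi / 15 * γ * (5 * γ - 1) * (6 * δ ^ 5)) δ := by
    have h := (hasDerivAt_pow 6 δ).const_mul (2 * Real.pi / 15 * γ * (5 * γ - 1))
    simpa using h
  have h := sphereLaw_of_tentLaw (V := fun y => γ • (y - c) + V y) (P := fun y => P y - γ * (1 - γ) / 2 * ‖y - c‖ ^ 2)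
    hWc hPic x₀ (E := fun ρ : ℝ => 2 * Real.pi / 15 * γ * (5 * γ - 1) * ρ ^ 6)
    (fun ρ hρ => transportMeanValueFormula γ c V P hprof x₀ ρ hρ) hδ hE
  rw [h]
  ring

/-- **TRANSPORT BALL LAW** (`NsregP2.R49.TransportBallLaw γ`, text VERBATIM, `transportW`/`modPressure` unfolded): the sharp law as
a `HasDerivAt` statement for the ball integrals of `⟪W,z⟫²/‖z‖² + Π`. [nsreg-p2 R49 §2.5] -/
theorem transportBallLaw (γ : ℝ) :
    ∀ (c : EuclideanSpace ℝ (Fin 3)) (V : EuclideanSpace ℝ (Fin 3) → EuclideanSpace ℝ (Fin 3)) (P : EuclideanSpace ℝ (Fin 3) → ℝ),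
      IsSelfSimilarEulerProfile γ c V P →
      ∀ (x₀ : EuclideanSpace ℝ (Fin 3)) (δ : ℝ), 0 < δ →
        HasDerivAt
          (fun r => ∫ y in ball x₀ r,
            (⟪γ • (y - c) + V y, y - x₀⟫ ^ 2 / ‖y - x₀‖ ^ 2 + (P y - γ * (1 - γ) / 2 * ‖y - c‖ ^ 2)))
          (((∫ y in ball x₀ δ, (‖γ • (y - c) + V y‖ ^ 2 + 3 * (P y - γ * (1 - γ) / 2 * ‖y - c‖ ^ 2)))
              + 4 * Real.pi / 5 * γ * (5 * γ - 1) * δ ^ 5) / δ)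
          δ := by
  intro c V P hprof x₀ δ hδ
  have hWc : Continuous fun y => γ • (y - c) + V y := by
    have := hprof.contDiff_velocity.continuous; fun_prop
  have hPic : Continuous fun y => P y - γ * (1 - γ) / 2 * ‖y - c‖ ^ 2 := by
    have := hprof.contDiff_pressure.continuous; fun_prop
  have hd := hasDerivAt_integral_ball_normalSq_add hWc hPic x₀ hδ
  have hs := transportSphereLaw γ c V P hprof x₀ δ hδ
  rw [sphereIntegral_normalSq_eq (V := fun y => γ • (y - c) + V y)
    (P := fun y => P y - γ * (1 - γ) / 2 * ‖y - c‖ ^ 2) x₀ hδ] at hs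
  refine hd.congr_deriv ?_
  rw [← hs, eq_div_iff hδ.ne']
  ring

/-- **KNOT VENTILATION** (`NsregP2.R49.KnotVentilation γ`, text VERBATIM, `transportW`/`modPressure` unfolded): if `S₁`, `S₂` are the
radial derivatives at `δ` of the ball integrals of `W_n² = ⟪W,z⟫²/‖z‖²` and of `Π`, then
`S₁/(4πδ²) ≥ (3/(4πδ³))∫_{B_δ(x₀)} Π − S₂/(4πδ²) + γ(5γ−1)δ²/5` (the missing term is `∫_{B_δ}‖W‖²/(4πδ³) ≥ 0`). [nsreg-p2 R49 §2.6] -/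
theorem knotVentilation (γ : ℝ) :
    ∀ (c : EuclideanSpace ℝ (Fin 3)) (V : EuclideanSpace ℝ (Fin 3) → EuclideanSpace ℝ (Fin 3)) (P : EuclideanSpace ℝ (Fin 3) → ℝ),
      IsSelfSimilarEulerProfile γ c V P →
      ∀ (x₀ : EuclideanSpace ℝ (Fin 3)) (δ S₁ S₂ : ℝ), 0 < δ →
        HasDerivAt (fun r => ∫ y in ball x₀ r, ⟪γ • (y - c) + V y, y - x₀⟫ ^ 2 / ‖y - x₀‖ ^ 2) S₁ δ →
        HasDerivAt (fun r => ∫ y in ball x₀ r, (P y - γ * (1 - γ) / 2 * ‖y - c‖ ^ 2)) S₂ δ →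
          S₁ / (4 * Real.pi * δ ^ 2)
            ≥ 3 / (4 * Real.pi * δ ^ 3) * (∫ y in ball x₀ δ, (P y - γ * (1 - γ) / 2 * ‖y - c‖ ^ 2))
              - S₂ / (4 * Real.pi * δ ^ 2) + γ * (5 * γ - 1) / 5 * δ ^ 2 := by
  intro c V P hprof x₀ δ S₁ S₂ hδ hS₁ hS₂
  have hWc : Continuous fun y => γ • (y - c) + V y := by
    have := hprof.contDiff_velocity.continuous; fun_prop
  have hPic : Continuous fun y => P y - γ * (1 - γ) / 2 * ‖y - c‖ ^ 2 := by
    have := hprof.contDiff_pressure.continuous; fun_prop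
  have hcn : Continuous fun y : EuclideanSpace ℝ (Fin 3) => ‖y - x₀‖ := continuous_norm.comp (continuous_sub_right x₀)
  -- the sum of the two ball integrals is the ball integral of the sum, at every radius
  have hsplit : (fun r => ∫ y in ball x₀ r,
      (⟪γ • (y - c) + V y, y - x₀⟫ ^ 2 / ‖y - x₀‖ ^ 2 + (P y - γ * (1 - γ) / 2 * ‖y - c‖ ^ 2))) =
      fun r => (∫ y in ball x₀ r, ⟪γ • (y - c) + V y, y - x₀⟫ ^ 2 / ‖y - x₀‖ ^ 2)
        + ∫ y in ball x₀ r, (P y - γ * (1 - γ) / 2 * ‖y - c‖ ^ 2) := by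
    funext r
    have h2 : IntegrableOn (fun y => P y - γ * (1 - γ) / 2 * ‖y - c‖ ^ 2) (ball x₀ r) volume :=
      (hPic.continuousOn.integrableOn_compact (isCompact_closedBall x₀ r)).mono_set ball_subset_closedBall
    have h12 := integrableOn_ball_normalSq_add hWc hPic x₀ r
    have h1 : IntegrableOn (fun y => ⟪γ • (y - c) + V y, y - x₀⟫ ^ 2 / ‖y - x₀‖ ^ 2) (ball x₀ r) volume :=
      (h12.sub h2).congr_fun (fun y _ => by simp) measurableSet_ball
    exact integral_add h1 h2
  have hBL := transportBallLaw γ c V P hprof x₀ δ hδ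
  rw [hsplit] at hBL
  have huniq := (hS₁.add hS₂).unique hBL
  -- split `∫ (‖W‖² + 3Π)` and use `∫ ‖W‖² ≥ 0`
  have iW : IntegrableOn (fun y => ‖γ • (y - c) + V y‖ ^ 2) (ball x₀ δ) volume :=
    ((hWc.norm.pow 2).continuousOn.integrableOn_compact (isCompact_closedBall x₀ δ)).mono_set ball_subset_closedBall
  have iPi : IntegrableOn (fun y => 3 * (P y - γ * (1 - γ) / 2 * ‖y - c‖ ^ 2)) (ball x₀ δ) volume :=
    ((hPic.const_mul 3).continuousOn.integrableOn_compact (isCompact_closedBall x₀ δ)).mono_set ball_subset_closedBall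
  rw [integral_add iW iPi, integral_const_mul] at huniq
  have hA : 0 ≤ ∫ y in ball x₀ δ, ‖γ • (y - c) + V y‖ ^ 2 := setIntegral_nonneg measurableSet_ball fun y _ => sq_nonneg _
  have hπ : 0 < Real.pi := Real.pi_pos
  set A : ℝ := ∫ y in ball x₀ δ, ‖γ • (y - c) + V y‖ ^ 2 with hAdef
  set B : ℝ := ∫ y in ball x₀ δ, (P y - γ * (1 - γ) / 2 * ‖y - c‖ ^ 2) with hBdef
  have hkey : S₁ / (4 * Real.pi * δ ^ 2) = A / (4 * Real.pi * δ ^ 3)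
      + (3 / (4 * Real.pi * δ ^ 3) * B - S₂ / (4 * Real.pi * δ ^ 2) + γ * (5 * γ - 1) / 5 * δ ^ 2) := by
    have hS₁ : S₁ = (A + 3 * B + 4 * Real.pi / 5 * γ * (5 * γ - 1) * δ ^ 5) / δ - S₂ := by linarith
    rw [hS₁]
    field_simp
    ring
  rw [ge_iff_le, hkey]
  have hnn : 0 ≤ A / (4 * Real.pi * δ ^ 3) := by positivity
  linarith

end ClassicalProfile

end Summit.NavierStokesRegularity.NavierStokesRegularity.Theorems.PowerGaugeEulerLiouville

end
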